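import Summits.ABC.StewartYu.KummerThirdLin
import HarnessLib

/-!
# Cell abc-stewartyu, M3 (rung F-A1 = Stewart–Yu 2001, exponent 1/3): the LINEAR Kummer door — the place bound at
# `p ∣ c` and the door `BakerMethodBounds_of_y07Lin` (insurance for the D-m0 fallback split of stmt-ABC-19658)

`Summits/ABC/StewartYu/KummerThirdLinDoor.lean` — cell `abc-stewartyu` (lit seat g8 on the route holder's assignment, plan g8
2026-08-27T03:34Z; theorems only, no named fact), sequel to `KummerThirdLin.lean` (the linear text `Y07AtLin`, the
linear place bound at `p ∣ a`).  Here: the linear place bound at `p ∣ c` (twin of p3's `placeBound_c_of_y07At` with the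
place factor `p` carried), the merge `y07AtLin_of_oddLin_two` of a LINEAR odd-`p` text with the strong `p = 2` text, and
**`BakerMethodBounds_of_y07Lin : ⟨Y07OddLin⟩ → ⟨Y07Two⟩ → BakerMethodBounds`** through lit's linear door
`Literature.Barriers.ABC.BakerMethodBounds_of_placeBoundsLin_kummerArchBound₂` with the tree's archimedean input
`waldschmidt1980_hW₂` (signatures verbatim from the planner's spec `HOME/plan/m3/split/LinDoorSpec.lean`); plus the
wiring check `BakerMethodBounds_of_y07_via_lin` (p3's strong door as a special case).  Elementary book-keeping
[cite: StewartYu2001, §3]; the texts themselves are NOT proved here.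
-/

noncomputable section

open Finset Real Height
open Literature.NumberTheory.DiophantineGeometry
open Literature.NumberTheory.DiophantineGeometry.Dioph
open Literature.NumberTheory.DiophantineGeometry.Pasten
open Literature.NumberTheory.Transcendental.Waldschmidt1980

namespace Summit.ABC.StewartYu.KummerThird

open Literature.Barriers.ABC

section PrimesDoorLin

variable {a b c : ℕ}

/-- **The linear place bound at `p ∣ c`** from the linear text at `p` (constant `C ≥ 0`, `ab > 1`): for an abc triple
`(a, b, c)` and a prime `p ∣ c`, `ν_p(c) log p < theta (max 4 C) a b 0 · (p (log p + log max{e, 2 log c}))` — `S` = the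
primes of `ab`, `e_q = 2(ν_q(a) − ν_q(b))`, `∏ q^{e_q} = (a/b)²`, `ord_p((a/b)² − 1) ≥ ν_p(c)` (twin of
`placeBound_c_of_y07At`, place factor carried). [cite: StewartYu2001, §3] -/
theorem placeBound_c_of_y07AtLin {C : ℝ} (hC0 : 0 ≤ C) (h : IsABCTriple a b c) (h1 : 1 < a * b) {p : ℕ}
    (hp : p.Prime) (hY : Y07AtLin C p) (hpc : p ∣ c) :
    (c.factorization p : ℝ) * Real.log p < theta (max 4 C) a b 0 *
      ((p : ℝ) * (Real.log p + Real.log (max (Real.exp 1) (2 * Real.log c)))) := by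
  classical
  obtain ⟨ha, hb, habc, hcop⟩ := id h
  have hc2 : 2 ≤ c := h.two_le
  have hc : 0 < c := by omega
  have hbc : b.Coprime c := coprime_right_of_isABCTriple h
  have hac : a.Coprime c := coprime_left_of_isABCTriple h
  set S := (a * b).primeFactors with hSdef
  set Y := Real.log (max (Real.exp 1) (2 * Real.log c)) with hYdef
  have hY1 : 1 ≤ Y := one_le_log_max_exp _
  have hS : ∀ q ∈ S, q.Prime := fun q hq => Nat.prime_of_mem_primeFactors hq
  have hpa : ¬p ∣ a := fun hpa =>
    hp.one_lt.ne' (Nat.dvd_one.mp (hac.gcd_eq_one ▸ Nat.dvd_gcd hpa hpc))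
  have hpb : ¬p ∣ b := fun hpb =>
    hp.one_lt.ne' (Nat.dvd_one.mp (hbc.gcd_eq_one ▸ Nat.dvd_gcd hpb hpc))
  have hpS : p ∉ S := by
    intro hpS'
    have hpab : p ∣ a * b := Nat.dvd_of_mem_primeFactors hpS'
    rcases (Nat.Prime.dvd_mul hp).mp hpab with h' | h'
    · exact hpa h'
    · exact hpb h'
  have hSne : S.Nonempty := by rw [hSdef, Nat.nonempty_primeFactors]; exact h1
  -- exponents and their bound
  set e : ℕ → ℤ := fun q => expDiff a b q * 2 with hedef
  set B : ℝ := max 3 (6 * Real.log c) with hBdef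
  have hB3 : (3 : ℝ) ≤ B := le_max_left _ _
  have hlogc : 0 ≤ Real.log c := Real.log_nonneg (by exact_mod_cast hc)
  have heB : ∀ q ∈ S, (|e q| : ℝ) ≤ B := by
    intro q hq
    have hq := hS q hq
    have h1' : (|e q| : ℝ) ≤ 2 * ((a.factorization q : ℝ) + (b.factorization q : ℝ)) := by
      simp only [hedef, expDiff]
      push_cast
      rw [abs_mul, abs_two]
      have := abs_sub (a.factorization q : ℝ) (b.factorization q : ℝ)
      rw [abs_of_nonneg (by positivity : (0 : ℝ) ≤ a.factorization q),
        abs_of_nonneg (by positivity : (0 : ℝ) ≤ b.factorization q)] at this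
      linarith
    have h2 := factorization_le_log_c (c := c) ha.ne' hq (by omega)
    have h3 := factorization_le_log_c (c := c) hb.ne' hq (by omega)
    exact h1'.trans (le_trans (by linarith) (le_max_right (3 : ℝ) (6 * Real.log c)))
  -- the product is `(a/b)²`
  have hb' : (b : ℚ) ≠ 0 := by exact_mod_cast hb.ne'
  have hprod : ∏ q ∈ S, (q : ℚ) ^ e q = ((a : ℚ) / b) ^ 2 := by
    rw [cast_div_eq_prod_zpow ha.ne' hb.ne' hcop, ← Finset.prod_pow]
    refine Finset.prod_congr rfl fun q _ => ?_
    simp only [hedef]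
    rw [zpow_mul, zpow_two, pow_two]
  have hab_ne : a ≠ b := by
    intro hab
    subst hab
    have : a = 1 := by simpa [Nat.coprime_self] using hcop
    subst this; simp at h1
  have hne1 : ∏ q ∈ S, (q : ℚ) ^ e q ≠ 1 := by
    rw [hprod]
    intro h2
    have hnn : (0 : ℚ) ≤ (a : ℚ) / b := by positivity
    have hab1 : (a : ℚ) / b = 1 := (pow_eq_one_iff_of_nonneg hnn two_ne_zero).mp h2
    rw [div_eq_one_iff_eq hb'] at hab1
    exact hab_ne (by exact_mod_cast hab1)
  -- the text
  have key := hY S hS hpS hSne e B hB3 heB hne1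
  rw [hprod] at key
  -- `ν_p(c) ≤ ord_p((a/b)² − 1)`
  haveI : Fact p.Prime := ⟨hp⟩
  have hxm : (a : ℚ) / b - 1 ≠ 0 := by
    rw [sub_ne_zero, Ne, div_eq_one_iff_eq hb']; exact_mod_cast hab_ne
  have hxp : (a : ℚ) / b + 1 ≠ 0 := by
    have : (0 : ℚ) ≤ (a : ℚ) / b := by positivity
    linarith
  have hfac : ((a : ℚ) / b) ^ 2 - 1 = ((a : ℚ) / b - 1) * ((a : ℚ) / b + 1) := by ring
  have hplus : (a : ℚ) / b + 1 = (c : ℚ) / b := by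
    field_simp; exact_mod_cast habc
  have hminus : (a : ℚ) / b - 1 = (((a : ℤ) - b : ℤ) : ℚ) / b := by
    field_simp; push_cast; ring
  have hz : ((a : ℤ) - b : ℤ) ≠ 0 := by omega
  have hvplus : padicValRat p ((a : ℚ) / b + 1) = c.factorization p := by
    rw [hplus, padicValRat.div (by exact_mod_cast hc.ne') hb', padicValRat.of_nat, padicValRat.of_nat,
      padicValNat.eq_zero_of_not_dvd hpb, Nat.factorization_def c hp]
    simp
  have hvminus : 0 ≤ padicValRat p ((a : ℚ) / b - 1) := by
    rw [hminus, padicValRat.div (by exact_mod_cast hz) hb', padicValRat.of_int, padicValRat.of_nat,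
      padicValNat.eq_zero_of_not_dvd hpb]
    simp
  have hv : (c.factorization p : ℤ) ≤ padicValRat p (((a : ℚ) / b) ^ 2 - 1) := by
    rw [hfac, padicValRat.mul hxm hxp, hvplus]; linarith
  have hp1 : (1 : ℝ) < p := by exact_mod_cast hp.one_lt
  have hlp : 0 < Real.log p := Real.log_pos hp1
  have key' : (c.factorization p : ℝ) * Real.log p <
      C ^ S.card * (p : ℝ) *
        (Real.log p + Real.log B + Real.log (Real.log ((max 4 (S.sup id) : ℕ) : ℝ))) *
        ∏ q ∈ S, Real.log (q : ℝ) := by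
    refine lt_of_le_of_lt (mul_le_mul_of_nonneg_right ?_ hlp.le) key
    exact_mod_cast hv
  -- compare the right-hand sides
  have hl2 : Real.log 2 ≤ Real.log p := Real.log_le_log two_pos (by exact_mod_cast hp.two_le)
  have hlog2 := Real.log_two_gt_d9
  have hpl : (0 : ℝ) ≤ (p : ℝ) := Nat.cast_nonneg p
  have hP : 0 ≤ ∏ q ∈ S, Real.log (q : ℝ) :=
    Finset.prod_nonneg fun q hq => Real.log_nonneg (by exact_mod_cast (hS q hq).one_lt.le)
  -- `log B ≤ log 3 + Y ≤ 2 + Y`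
  have hlogB : Real.log B ≤ 2 + Y := by
    have hM : B ≤ 3 * max (Real.exp 1) (2 * Real.log c) := by
      rw [hBdef]; refine max_le ?_ ?_
      · have := Real.exp_one_gt_d9
        have : (3 : ℝ) ≤ 3 * Real.exp 1 := by linarith
        exact this.trans (by gcongr; exact le_max_left _ _)
      · calc 6 * Real.log c = 3 * (2 * Real.log c) := by ring
          _ ≤ 3 * max (Real.exp 1) (2 * Real.log c) := by gcongr; exact le_max_right _ _
    have hM0 : 0 < max (Real.exp 1) (2 * Real.log c) := lt_of_lt_of_le (Real.exp_pos 1) (le_max_left _ _)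
    have h3 : Real.log (3 : ℝ) ≤ 2 := by
      have := Real.log_le_sub_one_of_pos (show (0 : ℝ) < 3 by norm_num); linarith
    calc Real.log B ≤ Real.log (3 * max (Real.exp 1) (2 * Real.log c)) :=
          Real.log_le_log (by linarith) hM
      _ = Real.log 3 + Y := by rw [Real.log_mul (by norm_num) hM0.ne']
      _ ≤ 2 + Y := by linarith
  -- `log log A ≤ log 2 + Y`
  have hllA : Real.log (Real.log ((max 4 (S.sup id) : ℕ) : ℝ)) ≤ Real.log 2 + Y := by
    refine loglog_le_of_le_four_mul_sq (c := c) (by exact_mod_cast le_max_left _ _) hc2 ?_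
    exact cast_max_four_sup_le (by nlinarith) hc2
  have hlog2' := Real.log_two_lt_d9
  have hsum : Real.log p + Real.log B + Real.log (Real.log ((max 4 (S.sup id) : ℕ) : ℝ)) ≤
      4 * (Real.log p + Y) := by linarith
  -- `C^n · 4 ≤ K^{n+1}`
  set K : ℝ := max 4 C with hKdef
  have hK4 : (4 : ℝ) ≤ K := le_max_left _ _
  have hCK : C ≤ K := le_max_right _ _
  have hpowK : C ^ S.card * 4 ≤ K ^ (S.card + 1) := by
    rw [pow_succ]
    exact mul_le_mul (pow_le_pow_left₀ hC0 hCK _) hK4 (by norm_num) (by positivity)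
  have hθ : theta K a b 0 = K ^ (S.card + 1) * ∏ q ∈ S, Real.log (q : ℝ) := by
    rw [theta_zero_eq K ha.ne' hb.ne' hcop]
  rw [hθ]
  set PL := ∏ q ∈ S, Real.log (q : ℝ) with hPL
  have hLY : 0 ≤ Real.log p + Y := by linarith
  calc (c.factorization p : ℝ) * Real.log p
      < C ^ S.card * (p : ℝ) *
          (Real.log p + Real.log B + Real.log (Real.log ((max 4 (S.sup id) : ℕ) : ℝ))) * PL := key'
    _ ≤ C ^ S.card * (p : ℝ) * (4 * (Real.log p + Y)) * PL := by
        have h0 : 0 ≤ C ^ S.card * (p : ℝ) := mul_nonneg (pow_nonneg hC0 _) hpl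
        exact mul_le_mul_of_nonneg_right (mul_le_mul_of_nonneg_left hsum h0) hP
    _ = (C ^ S.card * 4) * (PL * ((p : ℝ) * (Real.log p + Y))) := by ring
    _ ≤ K ^ (S.card + 1) * (PL * ((p : ℝ) * (Real.log p + Y))) := by
        have h0 : 0 ≤ PL * ((p : ℝ) * (Real.log p + Y)) := by positivity
        exact mul_le_mul_of_nonneg_right hpowK h0
    _ = K ^ (S.card + 1) * PL * ((p : ℝ) * (Real.log p + Y)) := by ring

/-! ### The linear door -/

/-- **Merging a LINEAR odd-`p` text with the strong `p = 2` text**: from `Y07OddLin` (odd `p`, constant `c₆`, place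
factor `p`) and `Y07Two` (`p = 2`, constant `c₆'`, place factor `2 / log 2`) the linear text holds at EVERY prime with
the non-negative constant `max(|c₆|, 2 max(1, |c₆'|))`. [folklore] -/
theorem y07AtLin_of_oddLin_two
    (hOdd : ∃ c₆ : ℝ, ∀ (p : ℕ), p.Prime → p ≠ 2 → ∀ (S : Finset ℕ), (∀ q ∈ S, q.Prime) → p ∉ S → S.Nonempty →
      ∀ (e : ℕ → ℤ) (B : ℝ), 3 ≤ B → (∀ q ∈ S, (|e q| : ℝ) ≤ B) →
      ∏ q ∈ S, (q : ℚ) ^ e q ≠ 1 →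
      (padicValRat p (∏ q ∈ S, (q : ℚ) ^ e q - 1) : ℝ) * Real.log p <
        c₆ ^ S.card * (p : ℝ) *
          (Real.log p + Real.log B + Real.log (Real.log ((max 4 (S.sup id) : ℕ) : ℝ))) *
          ∏ q ∈ S, Real.log (q : ℝ))
    (hTwo : ∃ c₆ : ℝ, ∀ (S : Finset ℕ), (∀ q ∈ S, q.Prime) → 2 ∉ S → S.Nonempty →
      ∀ (e : ℕ → ℤ) (B : ℝ), 3 ≤ B → (∀ q ∈ S, (|e q| : ℝ) ≤ B) →
      ∏ q ∈ S, (q : ℚ) ^ e q ≠ 1 →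
      (padicValRat 2 (∏ q ∈ S, (q : ℚ) ^ e q - 1) : ℝ) * Real.log 2 <
        c₆ ^ S.card * ((2 : ℝ) / Real.log 2) *
          (Real.log 2 + Real.log B + Real.log (Real.log ((max 4 (S.sup id) : ℕ) : ℝ))) *
          ∏ q ∈ S, Real.log (q : ℝ)) :
    ∃ C : ℝ, 0 ≤ C ∧ ∀ p : ℕ, p.Prime → Y07AtLin C p := by
  obtain ⟨c₁, h₁⟩ := hOdd
  obtain ⟨c₂, h₂⟩ := hTwo
  refine ⟨max |c₁| (2 * max 1 |c₂|), le_trans (abs_nonneg c₁) (le_max_left _ _), fun p hp => ?_⟩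
  by_cases hp2 : p = 2
  · subst hp2
    have h₂' : Y07At c₂ 2 := by
      intro S hS hpS hne e B hB heB hne1
      have := h₂ S hS hpS hne e B hB heB hne1
      simpa only [Nat.cast_ofNat] using this
    have h₂'' : Y07At (max 1 |c₂|) 2 := y07At_mono (le_max_right _ _) hp h₂'
    have h₃ : Y07AtLin (2 * max 1 |c₂|) 2 := y07AtLin_of_y07At (le_max_left _ _) hp h₂''
    refine y07AtLin_mono ?_ hp h₃
    rw [abs_of_nonneg (by positivity)]
    exact le_max_right _ _
  · exact y07AtLin_mono (le_max_left _ _) hp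
      (fun S hS hpS hne e B hB heB hne1 => h₁ p hp hp2 S hS hpS hne e B hB heB hne1)

/-- **THE LINEAR CELL DOOR**: `Y07OddLin → Y07Two → BakerMethodBounds` (twin of `BakerMethodBounds_of_y07`): a LINEAR
`p`-adic bound for rational primes at odd `p` and the Yu-2007-quality bound at `p = 2` give the barrier declaration
`BakerMethodBounds` (Stewart–Yu 2001's exponent `1/3`, `(log rad)³`) through lit's linear door
`BakerMethodBounds_of_placeBoundsLin_kummerArchBound₂`, the archimedean input being the tree's `waldschmidt1980_hW₂`.
[cite: StewartYu2001, Theorem 1 and §3] -/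
theorem BakerMethodBounds_of_y07Lin
    (hOdd : ∃ c₆ : ℝ, ∀ (p : ℕ), p.Prime → p ≠ 2 → ∀ (S : Finset ℕ), (∀ q ∈ S, q.Prime) → p ∉ S → S.Nonempty →
      ∀ (e : ℕ → ℤ) (B : ℝ), 3 ≤ B → (∀ q ∈ S, (|e q| : ℝ) ≤ B) →
      ∏ q ∈ S, (q : ℚ) ^ e q ≠ 1 →
      (padicValRat p (∏ q ∈ S, (q : ℚ) ^ e q - 1) : ℝ) * Real.log p <
        c₆ ^ S.card * (p : ℝ) *
          (Real.log p + Real.log B + Real.log (Real.log ((max 4 (S.sup id) : ℕ) : ℝ))) *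
          ∏ q ∈ S, Real.log (q : ℝ))
    (hTwo : ∃ c₆ : ℝ, ∀ (S : Finset ℕ), (∀ q ∈ S, q.Prime) → 2 ∉ S → S.Nonempty →
      ∀ (e : ℕ → ℤ) (B : ℝ), 3 ≤ B → (∀ q ∈ S, (|e q| : ℝ) ≤ B) →
      ∏ q ∈ S, (q : ℚ) ^ e q ≠ 1 →
      (padicValRat 2 (∏ q ∈ S, (q : ℚ) ^ e q - 1) : ℝ) * Real.log 2 <
        c₆ ^ S.card * ((2 : ℝ) / Real.log 2) *
          (Real.log 2 + Real.log B + Real.log (Real.log ((max 4 (S.sup id) : ℕ) : ℝ))) *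
          ∏ q ∈ S, Real.log (q : ℝ)) :
    BakerMethodBounds := by
  obtain ⟨C, hC0, hY⟩ := y07AtLin_of_oddLin_two hOdd hTwo
  exact BakerMethodBounds_of_placeBoundsLin_kummerArchBound₂ (K := max 4 C)
    (le_trans (by norm_num) (le_max_left _ _))
    (fun h _ hp hpa => placeBound_a_of_y07AtLin hC0 h hp (hY _ hp) hpa)
    (fun h h1 _ hp hpc => placeBound_c_of_y07AtLin hC0 h h1 hp (hY _ hp) hpc)
    w80Cw w80Cw_nonneg waldschmidt1980_hW₂

/- Wiring check (kernel-verified `example`, not a declaration — the statement is p3's landed `BakerMethodBounds_of_y07`):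
the strong door as a special case of the linear one (`Y07Odd`-shape at odd `p` with `c₆` gives the `Y07OddLin`-shape with
`2 max(1, |c₆|)`). -/
example
    (hOdd : ∃ c₆ : ℝ, ∀ (p : ℕ), p.Prime → p ≠ 2 → ∀ (S : Finset ℕ), (∀ q ∈ S, q.Prime) → p ∉ S → S.Nonempty →
      ∀ (e : ℕ → ℤ) (B : ℝ), 3 ≤ B → (∀ q ∈ S, (|e q| : ℝ) ≤ B) →
      ∏ q ∈ S, (q : ℚ) ^ e q ≠ 1 →
      (padicValRat p (∏ q ∈ S, (q : ℚ) ^ e q - 1) : ℝ) * Real.log p <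
        c₆ ^ S.card * ((p : ℝ) / Real.log p) *
          (Real.log p + Real.log B + Real.log (Real.log ((max 4 (S.sup id) : ℕ) : ℝ))) *
          ∏ q ∈ S, Real.log (q : ℝ))
    (hTwo : ∃ c₆ : ℝ, ∀ (S : Finset ℕ), (∀ q ∈ S, q.Prime) → 2 ∉ S → S.Nonempty →
      ∀ (e : ℕ → ℤ) (B : ℝ), 3 ≤ B → (∀ q ∈ S, (|e q| : ℝ) ≤ B) →
      ∏ q ∈ S, (q : ℚ) ^ e q ≠ 1 →
      (padicValRat 2 (∏ q ∈ S, (q : ℚ) ^ e q - 1) : ℝ) * Real.log 2 <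
        c₆ ^ S.card * ((2 : ℝ) / Real.log 2) *
          (Real.log 2 + Real.log B + Real.log (Real.log ((max 4 (S.sup id) : ℕ) : ℝ))) *
          ∏ q ∈ S, Real.log (q : ℝ)) :
    BakerMethodBounds := by
  obtain ⟨c₁, h₁⟩ := hOdd
  refine BakerMethodBounds_of_y07Lin ⟨2 * max 1 |c₁|, fun p hp hp2 => ?_⟩ hTwo
  have h' : Y07At c₁ p := fun S hS hpS hne e B hB heB hne1 => h₁ p hp hp2 S hS hpS hne e B hB heB hne1
  have h'' : Y07AtLin (2 * max 1 |c₁|) p :=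
    y07AtLin_of_y07At (le_max_left _ _) hp (y07At_mono (le_max_right _ _) hp h')
  exact fun S hS hpS hne e B hB heB hne1 => h'' S hS hpS hne e B hB heB hne1

end PrimesDoorLin

end Summit.ABC.StewartYu.KummerThird

end
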